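import Summits.QuantumFields.YangMills.Theorems.LangevinControlUVFemtoCurvatureTwoPointCSmallTorusVarianceOfRV
import HarnessLib

/-!
# Route `LangevinControlUV`, crux `FemtoCurvatureTwoPointC` (stmt-QuantumFields-16204), line `Sketch` —
# the small-torus variance law from the second-moment law `⟨S²⟩ ≤ K'/β²`

Registered stub `stub_smallTorusOfSecondMoment` of the skeleton `Cruxes/FemtoCurvatureTwoPointC/Lines/Sketch.lean`
(landed `--supports stmt-QuantumFields-16204`): for every compact `G` and lattice representation `r`,

  `(∀ L, ∃ K' β₀, ∀ β ≥ β₀, ⟨S²⟩_{L,β} ≤ K'/β²) → SmallTorusVarianceLawAt r`,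

i.e. the bare-coupling law `Var_{L,β}(P_0^{01}) ≤ K/β²` (`β ≥ β₀`, ONE `K`, ONE `β₀`) on the six small tori
`2 ≤ L ≤ 7`, from a second-moment bound for Wilson's action `S(U) = ∑ₚ (N − Re tr r.ρ(U_p)) ≥ 0` on every
fixed torus. Here `P_0^{01}(U) = N − Re tr r.ρ(U_{0;01}) ∈ [0, 2N]` is ONE plaquette term of `S`.

Proof (pure bookkeeping, modelled on the landed `smallTorusVarianceLaw_of_RV`):

* `Var P = ⟨P·P⟩ − ⟨P⟩² ≤ |⟨P·P⟩ − ⟨P⟩²| ≤ ⟨P²⟩` (`PlaquetteVariance.abs_var_le_wilsonExpectation_sq`);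
* pointwise `0 ≤ P_0^{01} ≤ S` (a single non-negative term of the sum, `sum_plaq01_le_wilsonAction` and
  `Finset.single_le_sum`), so `P² ≤ S²` and, Wilson's measure being a probability measure against which the
  bounded measurable `S²` is integrable, `⟨P²⟩ ≤ ⟨S²⟩ ≤ K'(L)/β²` for `β ≥ β₀(L)`;
* constants: `K := ∑_{n<8} |K'(n)|` (so `K'(L) ≤ K` for `L < 8`) and `β₀ := 1 + ∑_{n<8} |β₀(n)|`
  (so `β ≥ β₀` gives `β ≥ β₀(L)` for `L < 8` and `β ≥ 1 > 0`).
-/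

set_option autoImplicit false

noncomputable section

open MeasureTheory
open Literature.MathematicalPhysics.QuantumFieldTheory
open Summit.QuantumFields.YangMills.Theorems.FemtoCurvatureTwoPoint.PlaquetteVariance

namespace Summit.QuantumFields.YangMills.Theorems.FemtoCurvatureTwoPointC

section Helpers

variable {G : Type*} [Group G] [TopologicalSpace G] [IsTopologicalGroup G] [CompactSpace G]
  {N : ℕ} (ρ : G →* Matrix (Fin N) (Fin N) ℂ)

/-- Pointwise `P_0(U)² ≤ S(U)²` for the `01`-plaquette field at the origin: `0 ≤ P_0 ≤ S`, a single
non-negative term of the Wilson action. [folklore] -/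
theorem plaq01_sq_le_wilsonAction_sq (hρ : Continuous ρ) {L : ℕ} [NeZero L] (U : GaugeConfig 4 L G) :
    ((N : ℝ) - (ρ (plaquetteHolonomy U 0 0 1)).trace.re) ^ 2 ≤ wilsonAction ρ U ^ 2 := by
  have hρN := re_trace_le ρ hρ
  have h0 : ∀ g, 0 ≤ (N : ℝ) - (ρ g).trace.re := fun g => sub_nonneg.2 (hρN g)
  have hPS : (N : ℝ) - (ρ (plaquetteHolonomy U 0 0 1)).trace.re ≤ wilsonAction ρ U := by
    refine le_trans ?_ (sum_plaq01_le_wilsonAction ρ hρN U)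
    exact Finset.single_le_sum
      (f := fun x : Site 4 L => (N : ℝ) - (ρ (plaquetteHolonomy U x 0 1)).trace.re)
      (fun x _ => h0 _) (Finset.mem_univ (0 : Site 4 L))
  exact pow_le_pow_left₀ (h0 _) hPS 2

variable [MeasurableSpace G] [BorelSpace G]

/-- The squared Wilson action `S²` is integrable for every finite measure on the configurations of a
finite torus (bounded and measurable; continuous `ρ`). [folklore] -/
theorem integrable_wilsonAction_sq (hρ : Continuous ρ) {d L : ℕ} [NeZero L]
    (μ : Measure (GaugeConfig d L G)) [IsFiniteMeasure μ] :
    Integrable (fun U => wilsonAction ρ U ^ 2) μ := by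
  obtain ⟨B, hB⟩ := exists_abs_wilsonAction_le (d := d) (L := L) ρ hρ
  refine Integrable.of_bound
    ((WilsonRP.measurable_wilsonAction ρ hρ).pow_const 2).aestronglyMeasurable (B ^ 2)
    (ae_of_all _ fun U => ?_)
  rw [Real.norm_eq_abs, abs_pow]
  exact pow_le_pow_left₀ (abs_nonneg _) (hB U) 2

/-- **`⟨P_0²⟩_β ≤ ⟨S²⟩_β`** for the `01`-plaquette field at the origin (integrate the pointwise bound
`plaq01_sq_le_wilsonAction_sq` against Wilson's probability measure; only the right-hand side needs to
be integrable). [folklore] -/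
theorem wilsonExpectation_plaq01_sq_le_wilsonAction_sq (hρ : Continuous ρ) {L : ℕ} [NeZero L]
    (β : ℝ) :
    wilsonExpectation ρ β (fun U : GaugeConfig 4 L G =>
        ((N : ℝ) - (ρ (plaquetteHolonomy U 0 0 1)).trace.re) ^ 2) ≤
      wilsonExpectation ρ β (fun U : GaugeConfig 4 L G => wilsonAction ρ U ^ 2) := by
  haveI := isProbabilityMeasure_wilsonMeasure (d := 4) (L := L) ρ hρ β
  unfold wilsonExpectation
  exact integral_mono_of_nonneg (ae_of_all _ fun U => sq_nonneg _)
    (integrable_wilsonAction_sq ρ hρ _) (ae_of_all _ fun U => plaq01_sq_le_wilsonAction_sq ρ hρ U)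

end Helpers

/-- **The small-torus variance law from the second-moment law** (registered stub
`stub_smallTorusOfSecondMoment` of line `Sketch`, crux `FemtoCurvatureTwoPointC`, stmt-QuantumFields-16204).
For every compact `G` and lattice representation `r`: if on every torus `(ℤ/L)⁴` there are `K'(L)`, `β₀(L)`
with `⟨S²⟩_{L,β} ≤ K'(L)/β²` for `β ≥ β₀(L)`, then `Var_{L,β}(P_0^{01}) ≤ ⟨(P_0^{01})²⟩_β ≤ ⟨S²⟩_{L,β} ≤ K/β²`
for `2 ≤ L ≤ 7` and `β ≥ 1 + ∑_{n<8} |β₀(n)|`, with `K = ∑_{n<8} |K'(n)|`. [folklore] -/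
theorem stub_smallTorusOfSecondMoment :
    ∀ (G : Type) [Group G] [TopologicalSpace G] [IsTopologicalGroup G] [CompactSpace G] [MeasurableSpace G] [BorelSpace G]
      (r : LatticeRep G),
      (∀ (L : ℕ) [NeZero L], ∃ (K' β₀ : ℝ), ∀ β : ℝ, β₀ ≤ β →
          wilsonExpectation r.ρ β (fun U : GaugeConfig 4 L G => wilsonAction r.ρ U ^ 2) ≤ K' / β ^ 2) →
      SmallTorusVarianceLawAt r := by
  intro G i1 i2 i3 i4 i5 i6 r hS
  -- constants `K' L` and thresholds `B L` on every torus (junk values at `L = 0`)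
  have hS' : ∀ L : ℕ, ∃ (K' B : ℝ), ∀ β : ℝ, B ≤ β → ∀ [NeZero L],
      wilsonExpectation r.ρ β (fun U : GaugeConfig 4 L G => wilsonAction r.ρ U ^ 2) ≤ K' / β ^ 2 := by
    intro L
    by_cases hL0 : L = 0
    · refine ⟨0, 0, fun β _ => ?_⟩
      intro _
      exact absurd hL0 (NeZero.ne L)
    · haveI : NeZero L := ⟨hL0⟩
      obtain ⟨K', B, hKB⟩ := hS L
      refine ⟨K', B, fun β hβ => ?_⟩
      intro _
      exact hKB β hβ
  choose K' B hKB using hS'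
  refine ⟨∑ n ∈ Finset.range 8, |K' n|, 1 + ∑ n ∈ Finset.range 8, |B n|, ?_⟩
  intro L iL β _hL2 hL8 hβ P E hP hE
  subst hP hE
  dsimp only
  -- thresholds: `B L ≤ β` and `1 ≤ β`
  have hBL : B L ≤ β := by
    have h1 : |B L| ≤ ∑ n ∈ Finset.range 8, |B n| :=
      Finset.single_le_sum (f := fun n => |B n|) (fun n _ => abs_nonneg (B n))
        (Finset.mem_range.2 hL8)
    linarith [le_abs_self (B L)]
  have hβ1 : 1 ≤ β := by
    have h0 : 0 ≤ ∑ n ∈ Finset.range 8, |B n| := Finset.sum_nonneg fun n _ => abs_nonneg (B n)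
    linarith
  have hβ0 : 0 < β := lt_of_lt_of_le one_pos hβ1
  -- the constant: `K' L ≤ ∑_{n<8} |K' n|`
  have hKL : K' L ≤ ∑ n ∈ Finset.range 8, |K' n| := by
    have h1 : |K' L| ≤ ∑ n ∈ Finset.range 8, |K' n| :=
      Finset.single_le_sum (f := fun n => |K' n|) (fun n _ => abs_nonneg (K' n))
        (Finset.mem_range.2 hL8)
    exact (le_abs_self (K' L)).trans h1
  -- (i) `Var P ≤ |Var P| ≤ ⟨P²⟩`
  have hXm := measurable_plaq01 r.ρ r.continuous (0 : Site 4 L)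
  have hXb : ∀ U : GaugeConfig 4 L G,
      |(r.N : ℝ) - (r.ρ (plaquetteHolonomy U 0 0 1)).trace.re| ≤ 2 * r.N := fun U => by
    obtain ⟨h0, h2⟩ := plaqField_mem r.ρ r.continuous (plaquetteHolonomy U 0 0 1)
    rw [abs_of_nonneg h0]
    exact h2
  have hvar := abs_var_le_wilsonExpectation_sq r.ρ r.continuous β hXm hXb
  -- (ii) `⟨P²⟩ ≤ ⟨S²⟩`
  have hsq := wilsonExpectation_plaq01_sq_le_wilsonAction_sq (L := L) r.ρ r.continuous β
  -- (iii) `⟨S²⟩ ≤ K' L / β² ≤ K / β²`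
  have hmom : wilsonExpectation r.ρ β (fun U : GaugeConfig 4 L G => wilsonAction r.ρ U ^ 2) ≤
      K' L / β ^ 2 := hKB L β hBL
  have hK : K' L / β ^ 2 ≤ (∑ n ∈ Finset.range 8, |K' n|) / β ^ 2 :=
    div_le_div_of_nonneg_right hKL (by positivity)
  exact (le_abs_self _).trans (hvar.trans (hsq.trans (hmom.trans hK)))

end Summit.QuantumFields.YangMills.Theorems.FemtoCurvatureTwoPointC

end
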